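import Summits.QuantumFields.BalabanUV.T4Continuum.Support.NE3ProductPathChart
import HarnessLib

/-!
# T⁴ programme, node NE3 — THE PRODUCT-PATH CHART IS SLICE-GENERIC: `DecomposedRepT` (route Π's `DecomposedRep` with the direction set `T` as a
# parameter) gives an `EndpointChart` on `T` with the same displayed letters — so the slice-generic END (`NE3EnergyRateWCovOfEndpointChart`) and
# the R3 junction (`Spine/NE3/PairLandauB8.ne3EnergyRateWCov_of_pairLandauGaugeB8`) are fed by a DECOMPOSITION STATEMENT on any slice

Cell `pub-balaban-gaps` (YM blitz, track G2, seat `ne3`, unit `pub-balaban-gaps-ne3`; writer prover-pub-balaban-gaps-ne3-g2-0, 2026-08-22), repair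
**R3∕R24** of `run/shared/lean/pub/pub-balaban-gaps/ne/NE3.md` §4.  The owner lineage's `NE3ProductPathChart.endpointChart_of_decomposedRep` (route Π,
`b2b-balaban-t4-ne3-p1` gen 24) builds the endpoint chart of the local half of NE3 from the product path `W·e^{(1−t)²N}·e^{(t−1)X}` once the relative
field of the pair is split as `U_A^u = W·e^{N}·e^{−X}` with `X` in the owner's slice `T_♮(W) = frameFreeBlockLandauW L N k W`.  Its proof uses the slice
ONLY to place the reference direction (`refT := tangent`) and to know that members of the slice are periodic.  THIS FILE states the same theorem with
the slice as a PARAMETER: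

* §1 `DecomposedRepT 𝒞 L N k V U_A U_B u X N T α αN ν κ₁ κ₂ a` — `DecomposedRep` VERBATIM with `tangent : X ∈ T` and one structural field `perT`
  (members of `T` are `(N·L^k)`-periodic); `decomposedRepT_of_decomposedRep` — the owner's shape IS the instance `T := T_♮(W)`;
* §2 **`endpointChart_of_decomposedRepT`** — `DecomposedRepT … T α αN ν κ₁ κ₂ a` ⟹ `EndpointChart 𝒞 L N k V U_A U_B u (pathΓ X N) Ψ Ψ′ X T
  (energyNormW L k W · F) θ κ θ₀ 0 a` with the owner's displayed k-free letters `θ = 2(1 + 4√(16d+1))·ν`, `κ = 2κ₁ + 912·d·κ₂`,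
  `θ₀ = ν + 23√2·√(16d+1)·(1+ν)` — the owner's proof, token for token, with `T` free (credit: `b2b-balaban-t4-ne3-p1` gen 24; this seat changes
  three tokens);
USE (R24 of the census).  With `T := slicB8 W` (B8's surface: Landau (1.38) against `Δ_W N(Q′(W))` + the linearised double-bar constraint) the
successor supplies `DecomposedRepT` from `Spine/NE3/PairLandauB8.LandauRepB8` + (1.37) + a right inverse of `QbarIter` with letters; this file and
`NE3EnergyRateWCovOfEndpointChart` then give the covariant root modulo (P♮) and (RES♯) on that `T`.

HONEST FRAMING.  Kernel bookkeeping + the owner's elementary inequalities re-run with one set free; `DecomposedRepT` is a hypothesis SHAPE asserted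
for no configuration of Bałaban's; (P♮), (RES♯), T-E_w♯, the covariant root and **NE3 are NOT proved**; spine PROVED 0∕9; finite T⁴ rung (B)+1 —
NOT infinite volume, NOT mass gap, NOT `BetaPertH`, NOT Clay.  ABSOLUTE RULE kept (context only: [Balaban1985Variational] Prop. 2∕3 pp. 281∕289;
[Balaban1985RegularSpaces] Thm 2 p. 83).  PLACEMENT: `Summits/QuantumFields/BalabanUV/T4Continuum/Support/` next to `NE3ProductPathChart`; imports
it only; moves nothing.  HONEST DEPENDENCY: continuum YM on T⁴ ⇐ BetaPertH ∧ nine spine estimates (0/9 proved); BetaPertH ⇐ (D1) ∧ (D4) ∧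
CAP+tail; G-an2-4 gates asym, D1 and NE2/3/4.
-/

set_option autoImplicit false

open scoped BigOperators Matrix.Norms.L2Operator
open NormedSpace Finset

namespace Summit.QuantumFields.BalabanUV.T4Continuum.NE3ProductPathChartSlice

open Set
open Literature.MathematicalPhysics.QuantumFieldTheory.Balaban1983to89
open B7Prop1Explicit B7Prop2Explicit MatrixLog
open T4AveragingDeficitWall (IsSkewDir IsUnitaryCfg vary Ad curl curlAt curlSq dirSq dirL1 fhol)
open T4AveragingDeficitWallBoundary (periodBox)
open AveragingDeficitPeriodicCounting (IsPeriodicDir)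
open AveragingDeficitChartCalculus (cavg)
open MinimalActionLevels (perWin)
open MinimalActionSandwich (admissible)
open NE3EnergyShapes (IsUnitarySite IsPeriodicSite)
open NE3HessForm (dAction)
open NE3HessBounds (norm_curlAt_le)
open NE3HessContinuity (bondL1 bondL1At)
open NE3HessShapes (plaqsOf)
open NE3CurlStability (norm_curl_vary_sub_le)
open NE3EnergyWeightedShapes (energyNormW energyNormW_nonneg)
open NE3FrameFreeSliceW (frameFreeBlockLandauW)
open NE3ProductPathChart (DecomposedRep)
open NE3EnergyRateWSupOfSlicePoincare (mem_frameFreeBlockLandauW_struct)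
open NE3EndpointChart (EndpointChart)
open NE3ProductPath NE3ProductPathBounds NE3ProductPathSizes

noncomputable section

variable {d : ℕ} {n : Type*} [Fintype n] [DecidableEq n]

/-! ## §1 The decomposed representative of a pair ON A DIRECTION SET `T` -/

/-- **THE DECOMPOSED REPRESENTATIVE OF A PAIR ON A DIRECTION SET `T`** `(U_A, U_B)` at level `k` (background `W := cavg L U_B`, period
`P := N·L^k`, box `F := periodBox P`, window `perWin d P`, weighted norm `N_w := energyNormW L k W · F`): VERBATIM
`NE3ProductPathChart.DecomposedRep` with the slice `frameFreeBlockLandauW L N k W` replaced by the parameter `T` (field `tangent : X ∈ T`) and ONE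
more structural field `perT` (the members of `T` are `(N·L^k)`-periodic — for `T_♮(W)` a theorem, `mem_frameFreeBlockLandauW_struct`).  A hypothesis
SHAPE, asserted for nothing. [folklore] -/
@[folklore]
structure DecomposedRepT (𝒞 : ℕ → Set (Site d → Fin d → (Matrix n n ℂ)ˣ)) (L N k : ℕ)
    (V UA UB : Site d → Fin d → (Matrix n n ℂ)ˣ) (u : Site d → (Matrix n n ℂ)ˣ)
    (X Nn : Site d → Fin d → Matrix n n ℂ) (T : Set (Site d → Fin d → Matrix n n ℂ)) (α αN ν κ₁ κ₂ a : ℝ) : Prop where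
  /-- the gauge transformation is `U(N)`-valued and periodic -/
  gauge : IsUnitarySite u ∧ IsPeriodicSite u ((N * L ^ k : ℕ) : ℤ)
  /-- the bondwise product representation `U_A^u(b) = W(b)·e^{N(b)}·e^{−X(b)}` -/
  rep : ∀ (x : Site d) (μ : Fin d), ((gaugeAct u UA x μ : (Matrix n n ℂ)ˣ) : Matrix n n ℂ)
    = (cavg L UB x μ : Matrix n n ℂ) * (exp (Nn x μ) * exp (-X x μ))
  /-- the tangent datum is skew -/
  skewX : IsSkewDir X
  /-- the tangent datum is periodic -/
  perX : IsPeriodicDir X ((N * L ^ k : ℕ) : ℤ)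
  /-- the normal part is skew -/
  skewN : IsSkewDir Nn
  /-- the normal part is periodic -/
  perN : IsPeriodicDir Nn ((N * L ^ k : ℕ) : ℤ)
  /-- THE SLICE CONDITION: the tangent datum lies in the direction set `T` -/
  tangent : X ∈ T
  /-- the direction set consists of `(N·L^k)`-periodic directions -/
  perT : ∀ Y ∈ T, IsPeriodicDir Y ((N * L ^ k : ℕ) : ℤ)
  /-- sup bound of the tangent datum -/
  supX : ∀ (x : Site d) (μ : Fin d), ‖X x μ‖ ≤ α
  /-- sup bound of the normal part -/
  supN : ∀ (x : Site d) (μ : Fin d), ‖Nn x μ‖ ≤ αN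
  /-- the sup data are non-negative -/
  hα0 : 0 ≤ α
  /-- the sup data are non-negative -/
  hαN0 : 0 ≤ αN
  /-- numeric smallness of the sup data -/
  hα : α ≤ 1 / 32
  /-- numeric smallness of the sup data -/
  hαN : αN ≤ 1 / 64
  /-- the sup data are of size `L^{−k}` (the chart's (J1) letter) -/
  hαk : (α + αN) * (L : ℝ) ^ k ≤ 1
  /-- the background is admissible for run A -/
  admW : cavg L UB ∈ admissible 𝒞 L k V
  /-- the moving plaquette radius is non-negative -/
  ha : 0 ≤ a
  /-- the moving plaquette radius along the product path -/
  small : ∀ t ∈ Icc (0:ℝ) 1, ∀ p ∈ perWin d (N * L ^ k),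
    ‖((fhol (vary (cavg L UB) (pathΓ X Nn t) 1) p : (Matrix n n ℂ)ˣ) : Matrix n n ℂ) - 1‖ ≤ a
  /-- SIZE 1: the normal part is `ν`-small in the weighted norm, relative to the tangent datum -/
  nwN : energyNormW L k (cavg L UB) Nn (periodBox (N * L ^ k)) ≤ ν * energyNormW L k (cavg L UB) X (periodBox (N * L ^ k))
  /-- SIZE 2: the ℓ¹-curl of the normal part against the plaquette radius -/
  curlN : a * ∑ p ∈ perWin d (N * L ^ k), ‖curl (cavg L UB) Nn p‖ ≤ κ₁ * energyNormW L k (cavg L UB) X (periodBox (N * L ^ k)) ^ 2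
  /-- SIZE 3: the ℓ¹ norm of the normal part against the plaquette radius and the sup data -/
  l1N : a * ((α + αN) * dirL1 Nn (periodBox (N * L ^ k))) ≤ κ₂ * energyNormW L k (cavg L UB) X (periodBox (N * L ^ k)) ^ 2

/-- **THE OWNER'S SHAPE IS THE INSTANCE `T := T_♮(W)`**: a `DecomposedRep` is a `DecomposedRepT` on `frameFreeBlockLandauW L N k (cavg L U_B)` (its
members are periodic by `mem_frameFreeBlockLandauW_struct`). [folklore] -/
theorem decomposedRepT_of_decomposedRep
    {𝒞 : ℕ → Set (Site d → Fin d → (Matrix n n ℂ)ˣ)} {L N k : ℕ} {V UA UB : Site d → Fin d → (Matrix n n ℂ)ˣ}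
    {u : Site d → (Matrix n n ℂ)ˣ} {X Nn : Site d → Fin d → Matrix n n ℂ} {α αN ν κ₁ κ₂ a : ℝ}
    (h : DecomposedRep 𝒞 L N k V UA UB u X Nn α αN ν κ₁ κ₂ a) :
    DecomposedRepT 𝒞 L N k V UA UB u X Nn (frameFreeBlockLandauW L N k (cavg L UB)) α αN ν κ₁ κ₂ a where
  gauge := h.gauge
  rep := h.rep
  skewX := h.skewX
  perX := h.perX
  skewN := h.skewN
  perN := h.perN
  tangent := h.tangent
  perT := fun _ hY => (mem_frameFreeBlockLandauW_struct hY).2.1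
  supX := h.supX
  supN := h.supN
  hα0 := h.hα0
  hαN0 := h.hαN0
  hα := h.hα
  hαN := h.hαN
  hαk := h.hαk
  admW := h.admW
  ha := h.ha
  small := h.small
  nwN := h.nwN
  curlN := h.curlN
  l1N := h.l1N

/-! ## §2 The endpoint chart from a decomposed representative on any direction set -/

/-- **THE ENDPOINT CHART FROM A DECOMPOSED REPRESENTATIVE ON ANY DIRECTION SET `T`** — VERBATIM
`NE3ProductPathChart.endpointChart_of_decomposedRep` (same product path, same displayed letters) with `T_♮(W)` replaced by `T`; the owner's proof
uses the slice only through `refT := tangent` and the periodicity of its members (`perT`).  ORIGINAL DOCSTRING:  For `L, N ≥ 1`, a unitary background `W = cavg L U_B` and a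
decomposed representative of the pair with letters `(α, αN, ν, κ₁, κ₂, a)`, the product path `Γ = pathΓ X N` with its exact
velocities `Ψ t = vel`, `Ψ′ t = acc` is an `EndpointChart` on the slice `T_♮(W)` in the weighted norm, with reference direction `X`,
residual slack `q = 0`, plaquette radius `a`, and the DISPLAYED k-free letters
`θ = 2(1 + 4√(16d+1))·ν`, `κ = 2κ₁ + 912·d·κ₂`, `θ₀ = ν + 23√2·√(16d+1)·(1+ν)`. [folklore] -/
theorem endpointChart_of_decomposedRepT [Nonempty n] {𝒞 : ℕ → Set (Site d → Fin d → (Matrix n n ℂ)ˣ)} {L N k : ℕ}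
    (hL : 1 ≤ L) (hN : 1 ≤ N) {V UA UB : Site d → Fin d → (Matrix n n ℂ)ˣ} (hW : IsUnitaryCfg (cavg L UB))
    {u : Site d → (Matrix n n ℂ)ˣ} {X Nn : Site d → Fin d → Matrix n n ℂ} {T : Set (Site d → Fin d → Matrix n n ℂ)}
    {α αN ν κ₁ κ₂ a : ℝ} (h : DecomposedRepT 𝒞 L N k V UA UB u X Nn T α αN ν κ₁ κ₂ a) :
    EndpointChart 𝒞 L N k V UA UB u (pathΓ X Nn) (fun t x μ => vel (X x μ) (Nn x μ) t) (fun t x μ => acc (X x μ) (Nn x μ) t)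
      X T (fun Y => energyNormW L k (cavg L UB) Y (periodBox (N * L ^ k)))
      (2 * (1 + 4 * Real.sqrt (16 * d + 1)) * ν) (2 * κ₁ + 912 * d * κ₂)
      (ν + 23 * Real.sqrt 2 * Real.sqrt (16 * d + 1) * (1 + ν)) 0 a := by
  -- abbreviations and basic facts
  have hP : 1 ≤ N * L ^ k := Nat.mul_pos (by omega) (Nat.pow_pos (by omega))
  set W := cavg L UB with hWdef
  set F := periodBox (d := d) (N * L ^ k) with hF
  have hX32 : ∀ x μ, ‖X x μ‖ ≤ 1 / 32 := fun x μ => (h.supX x μ).trans h.hα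
  have hN64 : ∀ x μ, ‖Nn x μ‖ ≤ 1 / 64 := fun x μ => (h.supN x μ).trans h.hαN
  have hα1 : α ≤ 1 := h.hα.trans (by norm_num)
  have hLk1 : (1 : ℝ) ≤ (L : ℝ) ^ k := one_le_pow₀ (by exact_mod_cast hL)
  have hαk' : α * (L : ℝ) ^ k ≤ 1 := by nlinarith [h.hαk, h.hαN0, hLk1]
  have hsk' : (α + αN) * (L : ℝ) ^ k ≤ 1 := h.hαk
  have hs64 : Real.sqrt (16 * d + 1) ≥ 0 := Real.sqrt_nonneg _
  have hNX := energyNormW_nonneg L k W X F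
  have hNN := energyNormW_nonneg L k W Nn F
  have hνX : 0 ≤ ν * energyNormW L k W X F := hNN.trans h.nwN
  -- the conjugated normal part at time `t` and its size in the weighted norm
  have hC : ∀ t ∈ Icc (0:ℝ) 1, energyNormW L k W (fun x μ => conjN (X x μ) (Nn x μ) t) F
      ≤ (1 + 4 * Real.sqrt (16 * d + 1)) * (ν * energyNormW L k W X F) := by
    intro t ht
    obtain ⟨hCP, hCNP, -, -⟩ := NE3ProductPathChart.isPeriodicDir_fields h.perX h.perN t
    have hpt : ∀ x μ, ‖(fun x μ => conjN (X x μ) (Nn x μ) t - Nn x μ) x μ‖ ≤ (4 * α) * ‖Nn x μ‖ :=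
      fun x μ => norm_conjN_sub_le (h.skewX x μ) (h.supX x μ) hα1 ht
    have hdiff := energyNormW_le_of_pointwise hW hL k hP hCNP (by linarith [h.hα0]) hpt
    have hsplit : (fun x μ => conjN (X x μ) (Nn x μ) t) = Nn + (fun x μ => conjN (X x μ) (Nn x μ) t - Nn x μ) := by
      funext x μ; simp
    have hadd := energyNormW_add_le L k W Nn (fun x μ => conjN (X x μ) (Nn x μ) t - Nn x μ) F
    rw [← hsplit] at hadd
    have hstep : Real.sqrt (16 * d + 1) * (4 * α) * (L : ℝ) ^ k * energyNormW L k W Nn F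
        ≤ 4 * Real.sqrt (16 * d + 1) * energyNormW L k W Nn F := by
      have h3 := mul_le_mul_of_nonneg_left hαk' (mul_nonneg hs64 hNN)
      calc Real.sqrt (16 * d + 1) * (4 * α) * (L : ℝ) ^ k * energyNormW L k W Nn F
          = 4 * ((Real.sqrt (16 * d + 1) * energyNormW L k W Nn F) * (α * (L : ℝ) ^ k)) := by ring
        _ ≤ 4 * ((Real.sqrt (16 * d + 1) * energyNormW L k W Nn F) * 1) := mul_le_mul_of_nonneg_left h3 (by norm_num)
        _ = 4 * Real.sqrt (16 * d + 1) * energyNormW L k W Nn F := by ring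
    calc energyNormW L k W (fun x μ => conjN (X x μ) (Nn x μ) t) F
        ≤ energyNormW L k W Nn F + 4 * Real.sqrt (16 * d + 1) * energyNormW L k W Nn F := by linarith
      _ = (1 + 4 * Real.sqrt (16 * d + 1)) * energyNormW L k W Nn F := by ring
      _ ≤ (1 + 4 * Real.sqrt (16 * d + 1)) * (ν * energyNormW L k W X F) :=
          mul_le_mul_of_nonneg_left h.nwN (by positivity)
  refine
    { gauge := h.gauge
      rep := eq_vary_pathΓ_zero h.skewX h.skewN hX32 hN64 W (gaugeAct u UA) h.rep
      endW := pathΓ_one X Nn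
      skew := isSkewDir_pathΓ X Nn
      per := fun t => isPeriodicDir_pathΓ h.perX h.perN t
      vel := fun t ht y μ => hasDerivAt_exp_pathΓ h.skewX h.skewN hX32 hN64 ht y μ
      acc := fun t _ y μ => hasDerivAt_vel (X y μ) (Nn y μ) t
      skewAcc := fun t _ x μ => acc_mem_skewAdjoint (h.skewX x μ) (h.skewN x μ) t
      admW := h.admW
      refT := h.tangent
      perT := h.perT
      velocity := ?_
      close := ?_
      resDev := ?_
      small := h.small
      accel := ?_ }
  · -- velocity: `Ψ t − X = −2(1−t)•C t`
    intro t ht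
    have e : (fun x μ => vel (X x μ) (Nn x μ) t) - X
        = ((((-2 * (1 - t)) : ℝ) : ℂ)) • (fun x μ => conjN (X x μ) (Nn x μ) t) := by
      funext x μ; simp only [Pi.sub_apply, Pi.smul_apply, vel]; abel
    rw [e, energyNormW_smul, Complex.norm_real, Real.norm_eq_abs]
    have hc : |-2 * (1 - t)| ≤ 2 := by rw [abs_le]; constructor <;> nlinarith [ht.1, ht.2]
    have hCt := hC t ht
    have h0 := energyNormW_nonneg L k W (fun x μ => conjN (X x μ) (Nn x μ) t) F
    calc |-2 * (1 - t)| * energyNormW L k W (fun x μ => conjN (X x μ) (Nn x μ) t) F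
        ≤ 2 * ((1 + 4 * Real.sqrt (16 * d + 1)) * (ν * energyNormW L k W X F)) := by nlinarith
      _ = 2 * (1 + 4 * Real.sqrt (16 * d + 1)) * ν * energyNormW L k W X F := by ring
  · -- close: `Γ 0 = (N − X) + R`, `‖R b‖ ≤ 23(α+αN)(‖N b‖ + ‖X b‖)`
    obtain ⟨-, -, -, hRP⟩ := NE3ProductPathChart.isPeriodicDir_fields h.perX h.perN 0
    have hpt : ∀ x μ, ‖(fun x μ => pathΓ X Nn 0 x μ - (Nn x μ - X x μ)) x μ‖ ≤ (23 * (α + αN)) * (‖Nn x μ‖ + ‖X x μ‖) :=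
      fun x μ => norm_pathΓ_zero_sub_le h.skewX h.skewN h.supX h.supN h.hα h.hαN x μ
    have hR := energyNormW_le_of_pointwise₂ hW hL k hP hRP (by nlinarith [h.hα0, h.hαN0]) hpt
    have hsplit : pathΓ X Nn 0 = (Nn - X) + (fun x μ => pathΓ X Nn 0 x μ - (Nn x μ - X x μ)) := by
      funext x μ; simp
    have hadd := energyNormW_add_le L k W (Nn - X) (fun x μ => pathΓ X Nn 0 x μ - (Nn x μ - X x μ)) F
    rw [← hsplit] at hadd
    have hsub := energyNormW_sub_le L k W Nn X F
    have hstep : Real.sqrt 2 * Real.sqrt (16 * d + 1) * (23 * (α + αN)) * (L : ℝ) ^ k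
          * (energyNormW L k W Nn F + energyNormW L k W X F)
        ≤ 23 * Real.sqrt 2 * Real.sqrt (16 * d + 1) * (energyNormW L k W Nn F + energyNormW L k W X F) := by
      have h2 : 0 ≤ Real.sqrt 2 * Real.sqrt (16 * d + 1) * (energyNormW L k W Nn F + energyNormW L k W X F) :=
        mul_nonneg (mul_nonneg (Real.sqrt_nonneg _) (Real.sqrt_nonneg _)) (add_nonneg hNN hNX)
      have h3 := mul_le_mul_of_nonneg_left hsk' h2
      calc Real.sqrt 2 * Real.sqrt (16 * d + 1) * (23 * (α + αN)) * (L : ℝ) ^ k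
              * (energyNormW L k W Nn F + energyNormW L k W X F)
          = 23 * ((Real.sqrt 2 * Real.sqrt (16 * d + 1) * (energyNormW L k W Nn F + energyNormW L k W X F))
              * ((α + αN) * (L : ℝ) ^ k)) := by ring
        _ ≤ 23 * ((Real.sqrt 2 * Real.sqrt (16 * d + 1) * (energyNormW L k W Nn F + energyNormW L k W X F)) * 1) :=
            mul_le_mul_of_nonneg_left h3 (by norm_num)
        _ = 23 * Real.sqrt 2 * Real.sqrt (16 * d + 1) * (energyNormW L k W Nn F + energyNormW L k W X F) := by ring
    have hsum : energyNormW L k W Nn F + energyNormW L k W X F ≤ (1 + ν) * energyNormW L k W X F := by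
      linarith [h.nwN]
    have hK : 0 ≤ 23 * Real.sqrt 2 * Real.sqrt (16 * d + 1) :=
      mul_nonneg (mul_nonneg (by norm_num) (Real.sqrt_nonneg _)) (Real.sqrt_nonneg _)
    calc energyNormW L k W (pathΓ X Nn 0) F
        ≤ (1 + 23 * Real.sqrt 2 * Real.sqrt (16 * d + 1)) * (energyNormW L k W Nn F + energyNormW L k W X F) := by
          linarith
      _ ≤ (1 + 23 * Real.sqrt 2 * Real.sqrt (16 * d + 1)) * ((1 + ν) * energyNormW L k W X F) :=
          mul_le_mul_of_nonneg_left hsum (by linarith)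
      _ = (1 + (ν + 23 * Real.sqrt 2 * Real.sqrt (16 * d + 1) * (1 + ν))) * energyNormW L k W X F := by ring
  · -- resDev: `Ψ 1 = X`
    have e : (fun x μ => vel (X x μ) (Nn x μ) 1) = X := by funext x μ; exact vel_one _ _
    rw [e, zero_mul, add_zero]
  · -- accel
    intro t ht
    obtain ⟨hCP, hCNP, hAP, -⟩ := NE3ProductPathChart.isPeriodicDir_fields h.perX h.perN t
    have hWt : IsUnitaryCfg (vary W (pathΓ X Nn t) 1) := AveragingDeficitPlaqDeriv.vary_isUnitaryCfg hW (isSkewDir_pathΓ X Nn t) 1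
    -- pointwise sizes
    have hΓ : ∀ x μ, ‖pathΓ X Nn t x μ‖ ≤ 6 * (α + αN) := fun x μ => norm_pathΓ_le h.skewX h.skewN h.supX h.supN h.hα h.hαN ht x μ
    have hCN : ∀ x μ, ‖(fun x μ => conjN (X x μ) (Nn x μ) t - Nn x μ) x μ‖ ≤ (4 * α) * ‖Nn x μ‖ :=
      fun x μ => norm_conjN_sub_le (h.skewX x μ) (h.supX x μ) hα1 ht
    have hK : ∀ x μ, ‖(fun x μ => X x μ * conjN (X x μ) (Nn x μ) t - conjN (X x μ) (Nn x μ) t * X x μ) x μ‖ ≤ (2 * α) * ‖Nn x μ‖ := by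
      intro x μ
      have hCx := norm_conjN_eq (h.skewX x μ) (Nn x μ) t
      calc ‖X x μ * conjN (X x μ) (Nn x μ) t - conjN (X x μ) (Nn x μ) t * X x μ‖
          ≤ ‖X x μ * conjN (X x μ) (Nn x μ) t‖ + ‖conjN (X x μ) (Nn x μ) t * X x μ‖ := norm_sub_le _ _
        _ ≤ ‖X x μ‖ * ‖conjN (X x μ) (Nn x μ) t‖ + ‖conjN (X x μ) (Nn x μ) t‖ * ‖X x μ‖ := add_le_add (norm_mul_le _ _) (norm_mul_le _ _)
        _ ≤ (2 * α) * ‖Nn x μ‖ := by rw [hCx]; nlinarith [h.supX x μ, norm_nonneg (Nn x μ), norm_nonneg (X x μ)]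
    have hA : ∀ x μ, ‖(fun x μ => acc (X x μ) (Nn x μ) t) x μ‖ ≤ 3 * ‖Nn x μ‖ := fun x μ =>
      (norm_acc_le (h.skewX x μ) (h.supX x μ) (Nn x μ) ht).trans (by nlinarith [h.hα, norm_nonneg (Nn x μ)])
    -- per plaquette
    have hplaq : ∀ p ∈ perWin d (N * L ^ k),
        ‖curl (vary W (pathΓ X Nn t) 1) (fun x μ => acc (X x μ) (Nn x μ) t) p‖
          ≤ 2 * ‖curl W Nn p‖ + 228 * (α + αN) * bondL1 Nn p := by
      intro p _
      set Z : Site d → Fin d → Matrix n n ℂ := fun x μ => acc (X x μ) (Nn x μ) t with hZ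
      set Cf : Site d → Fin d → Matrix n n ℂ := fun x μ => conjN (X x μ) (Nn x μ) t with hCf
      set Kf : Site d → Fin d → Matrix n n ℂ :=
        fun x μ => X x μ * conjN (X x μ) (Nn x μ) t - conjN (X x μ) (Nn x μ) t * X x μ with hKf
      have hbN : 0 ≤ bondL1 Nn p := NE3HessContinuity.bondL1At_nonneg Nn p.1 p.2.1.1 p.2.1.2
      have hs0 : 0 ≤ α + αN := by linarith [h.hα0, h.hαN0]
      -- (i) the moving configuration vs the background
      have hδ : Real.exp (|(1:ℝ)| * (6 * (α + αN))) - 1 ≤ 12 * (α + αN) := by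
        rw [abs_one, one_mul]
        have h6 : 0 ≤ 6 * (α + αN) := by nlinarith
        have := Real.abs_exp_sub_one_le (x := 6 * (α + αN)) (by rw [abs_of_nonneg h6]; nlinarith [h.hα, h.hαN])
        rw [abs_of_nonneg h6] at this
        linarith [le_abs_self (Real.exp (6 * (α + αN)) - 1)]
      have hbZ : bondL1 Z p ≤ 3 * bondL1 Nn p := bondL1_le_of_pointwise hA p
      have h1 := norm_curl_vary_sub_le hW (isSkewDir_pathΓ X Nn t) hΓ 1 Z p
      have hmove : ‖curl (vary W (pathΓ X Nn t) 1) Z p‖ ≤ ‖curl W Z p‖ + 216 * (α + αN) * bondL1 Nn p := by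
        have h2 : 6 * (Real.exp (|(1:ℝ)| * (6 * (α + αN))) - 1) * bondL1 Z p ≤ 6 * (12 * (α + αN)) * (3 * bondL1 Nn p) := by
          have hE : 0 ≤ Real.exp (|(1:ℝ)| * (6 * (α + αN))) - 1 := by
            rw [abs_one, one_mul]; have := Real.add_one_le_exp (6 * (α + αN)); nlinarith
          have hbZ0 : 0 ≤ bondL1 Z p := NE3HessContinuity.bondL1At_nonneg Z p.1 p.2.1.1 p.2.1.2
          exact mul_le_mul (by nlinarith) hbZ hbZ0 (by positivity)
        have h3 := norm_le_norm_add_norm_sub' (curl (vary W (pathΓ X Nn t) 1) Z p) (curl W Z p)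
        linarith
      -- (ii) the curl at `W` of `Ψ′ = 2•C + 2(1−t)•[X, C]`
      have hZsplit : Z = ((2 : ℝ) : ℂ) • Cf + (((2 * (1 - t)) : ℝ) : ℂ) • Kf := by
        funext x μ; simp only [hZ, hCf, hKf, Pi.add_apply, Pi.smul_apply, acc]
      have hCNpt : ∀ x μ, ‖(Cf - Nn) x μ‖ ≤ (4 * α) * ‖Nn x μ‖ := fun x μ => by
        simpa only [Pi.sub_apply, hCf] using hCN x μ
      have hc1 : ‖curl W Cf p‖ ≤ ‖curl W Nn p‖ + 4 * α * bondL1 Nn p := by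
        have e : curl W Cf p = curl W Nn p + curl W (Cf - Nn) p := by rw [← curl_add_dir, add_sub_cancel]
        rw [e]
        refine (norm_add_le _ _).trans (add_le_add le_rfl ?_)
        have h4 : ‖curl W (Cf - Nn) p‖ ≤ bondL1 (Cf - Nn) p := norm_curlAt_le hW (Cf - Nn) p.1 p.2.1.1 p.2.1.2
        exact h4.trans (bondL1_le_of_pointwise hCNpt p)
      have hc2 : ‖curl W Kf p‖ ≤ 2 * α * bondL1 Nn p := by
        have h4 : ‖curl W Kf p‖ ≤ bondL1 Kf p := norm_curlAt_le hW Kf p.1 p.2.1.1 p.2.1.2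
        exact h4.trans (bondL1_le_of_pointwise hK p)
      have hcurlZ : ‖curl W Z p‖ ≤ 2 * ‖curl W Nn p‖ + 12 * α * bondL1 Nn p := by
        rw [hZsplit, curl_add_dir, curl_smul_dir, curl_smul_dir]
        refine (norm_add_le _ _).trans ?_
        rw [norm_smul, norm_smul, Complex.norm_real, Complex.norm_real, Real.norm_eq_abs, Real.norm_eq_abs,
          abs_of_pos (by norm_num : (0:ℝ) < 2)]
        have hc : |2 * (1 - t)| ≤ 2 := by rw [abs_le]; constructor <;> nlinarith [ht.1, ht.2]
        have h5 : |2 * (1 - t)| * ‖curl W Kf p‖ ≤ 2 * (2 * α * bondL1 Nn p) :=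
          mul_le_mul hc hc2 (norm_nonneg _) (by norm_num)
        nlinarith [hc1, h5]
      have h12 : 12 * α * bondL1 Nn p ≤ 12 * (α + αN) * bondL1 Nn p := by nlinarith [h.hαN0]
      linarith [hmove, hcurlZ, h12]
    -- sum over the window and multiply by the plaquette radius
    have hsumB : ∑ p ∈ perWin d (N * L ^ k), bondL1 Nn p ≤ 4 * d * dirL1 Nn F := by
      rw [NE3EnergyHessCont.perWin_eq_plaqsOf]; exact sum_plaqsOf_bondL1_le hP h.perN
    have hs0 : 0 ≤ α + αN := by linarith [h.hα0, h.hαN0]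
    have hsum : ∑ p ∈ perWin d (N * L ^ k), ‖curl (vary W (pathΓ X Nn t) 1) (fun x μ => acc (X x μ) (Nn x μ) t) p‖
        ≤ 2 * ∑ p ∈ perWin d (N * L ^ k), ‖curl W Nn p‖ + 228 * (α + αN) * (4 * d * dirL1 Nn F) := by
      calc ∑ p ∈ perWin d (N * L ^ k), ‖curl (vary W (pathΓ X Nn t) 1) (fun x μ => acc (X x μ) (Nn x μ) t) p‖
          ≤ ∑ p ∈ perWin d (N * L ^ k), (2 * ‖curl W Nn p‖ + 228 * (α + αN) * bondL1 Nn p) := Finset.sum_le_sum hplaq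
        _ = 2 * ∑ p ∈ perWin d (N * L ^ k), ‖curl W Nn p‖ + 228 * (α + αN) * ∑ p ∈ perWin d (N * L ^ k), bondL1 Nn p := by
            rw [Finset.sum_add_distrib, ← Finset.mul_sum, ← Finset.mul_sum]
        _ ≤ _ := by
            have := mul_le_mul_of_nonneg_left hsumB (show 0 ≤ 228 * (α + αN) by positivity)
            linarith
    have hfin : a * (2 * ∑ p ∈ perWin d (N * L ^ k), ‖curl W Nn p‖ + 228 * (α + αN) * (4 * d * dirL1 Nn F))
        = 2 * (a * ∑ p ∈ perWin d (N * L ^ k), ‖curl W Nn p‖) + 912 * d * (a * ((α + αN) * dirL1 Nn F)) := by ring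
    calc a * ∑ p ∈ perWin d (N * L ^ k), ‖curl (vary W (pathΓ X Nn t) 1) (fun x μ => acc (X x μ) (Nn x μ) t) p‖
        ≤ a * (2 * ∑ p ∈ perWin d (N * L ^ k), ‖curl W Nn p‖ + 228 * (α + αN) * (4 * d * dirL1 Nn F)) :=
          mul_le_mul_of_nonneg_left hsum h.ha
      _ = 2 * (a * ∑ p ∈ perWin d (N * L ^ k), ‖curl W Nn p‖) + 912 * d * (a * ((α + αN) * dirL1 Nn F)) := hfin
      _ ≤ 2 * (κ₁ * energyNormW L k W X F ^ 2) + 912 * d * (κ₂ * energyNormW L k W X F ^ 2) := by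
          have hd0 : (0:ℝ) ≤ 912 * d := by positivity
          nlinarith [h.curlN, h.l1N, mul_le_mul_of_nonneg_left h.l1N hd0]
      _ = (2 * κ₁ + 912 * d * κ₂) * energyNormW L k W X F ^ 2 := by ring

end


end Summit.QuantumFields.BalabanUV.T4Continuum.NE3ProductPathChartSlice
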